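import Literature.AlgebraicGeometry.Resolution.HenselizedFunctionFields
import Literature.AlgebraicGeometry.Resolution.HenselizationHenselian
import HarnessLib

/-!
# The proof of (R4) for `K(x)^h`, `x` residue-transcendental: the induction of p. 20 (Kuhlmann 2010, §5)

Topic: `Literature/AlgebraicGeometry/Resolution` (valued function fields). PROVED assembly of the
named fact `Kuhlmann2010StabilityHenselizedRationalResidueTranscendental`
(`GeneralizedStabilityRankOneHenselized.lean`: the henselized rational function field `K(x)^h` of
rank one with a residue-transcendental generator over an algebraically closed `K` is a defectless
field) from the ingredients of its printed proof, F.-V. Kuhlmann, *Elimination of ramification I*,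
Trans. AMS 362 (2010) = arXiv:1003.5678, pp. 18–20, vendored in `HenselizedFunctionFields.lean`:
Cor. 2.12 (residue characteristic `0`), the henselization is henselian (§1.1, Lemma 2.3;
`Henselization.lean`), the reduction to a tower of normal extensions of degree `p` over a finite
unramified `N` (pp. 18–19 with Lemma 2.27), Prop. 2.18, Cor. 4.2 / Prop. 3.1 for the steps of the
tower, and Lemma 5.5. The argument rendered here is the one printed on p. 20:

> The proof that `E.N|N` is defectless now proceeds by induction on the number of extensions
> appearing in the tower. … there is a normal subextension `E'|N` of `E.N|N` of degree `p`. By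
> Corollary 4.2 or Proposition 3.1, this extension is defectless. From the preceding lemma we
> infer that `E'` is again a henselized inertially generated function field … By induction
> hypothesis, `(E|E',v)` is also defectless since it has a smaller degree than `E|N`. Hence by
> Lemma 2.13, `(E|N,v)` is defectless.

followed by "By Proposition 2.18 we have `d(E|F,v) = d(E.N|N,v)`" (p. 19) to return to `E|F`, and
by the passage from the finite subextensions `E` of `Ω|F` to all finite extensions of the
henselian field `F = K(x)^h` ("Note that `g = 1` if `(K,v)` is henselian", §1: the unique
extension of `v` to `E` is `V ∩ E`, so "defectless in `E`" is `[E : F] = e·f`).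

## Content (everything PROVED)

* `isDefectlessField_of_forall_intermediateField` — inside an algebraically closed `Ω`, a
  subfield `F` valued by `V ∩ F` is a defectless field as soon as it is defectless in every
  finite subextension `E` of `Ω|F` (every finite extension of `F` embeds into `Ω` over `F`,
  `IsAlgClosed.lift`; `IsDefectlessIn.congr`).
* `isDefectlessIn_of_isDefectlessExtension` — over a henselian `F ≤ Ω`, the ambient
  `IsDefectlessExtension V F E` (`[E : F] = (vE : vF)[Ev : Fv]`) is `IsDefectlessIn F (V ∩ F) E`
  (uniqueness of the extension `V ∩ E`; `e`, `f` through `DefectAmbient.lean`).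
* `IsUnramifiedOver.trans`, `IsHenselizedInertiallyGeneratedRT.of_isUnramifiedOver` — finite
  unramified extensions compose; Lemma 2.27 (residue-transcendental case) in the form used on
  p. 19: a finite unramified extension of a field of the class is in the class.
* `IsNormalPTower.isDefectlessExtension` — the induction of p. 20 along a tower of normal
  extensions of degree `p` starting in the class `IsHenselizedInertiallyGeneratedRT V K`.
* `Kuhlmann2010StabilityHenselizedRationalResidueTranscendental.of_parts` — the assembly.

Hence (`GeneralizedStabilityRankOneHenselized.lean`) `Kuhlmann2010StabilityRankOneResidueTranscendental`
rests on: `Kuhlmann2010DefectlessIffHenselization` (Thm. 2.14),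
`Kuhlmann2010DefectlessOfResidueCharZero` (Cor. 2.12), `Kuhlmann2010TameTowerReduction`
(pp. 18–19, Lemma 2.27), `Kuhlmann2010DefectUnramifiedBaseChange` (Prop. 2.18),
`Kuhlmann2010NormalDegreePDefectless` (Cor. 4.2, Prop. 3.1) and
`Kuhlmann2010FiniteExtensionInertiallyGenerated` (Lemma 5.5) —
`Kuhlmann2010StabilityRankOneResidueTranscendental.of_ingredients` (the henselization being
henselian, §1.1, is PROVED in `HenselizationHenselian.lean` and fed in there).

## Sources

* F.-V. Kuhlmann, Trans. AMS 362 (2010) = arXiv:1003.5678: §1 ("`g = 1` if `(K,v)` is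
  henselian"), §2.3 (Cor. 2.12, Lemma 2.13, Prop. 2.18), §5, proof of (R4), pp. 18–20.
-/

noncomputable section

open IsLocalRing

namespace Literature.AlgebraicGeometry.Resolution

universe u

variable {Ω : Type u} [Field Ω] (V : ValuationSubring Ω)

/-! ### From finite subextensions of `Ω|F` to all finite extensions -/

/-- **A subfield `F ≤ Ω` (`Ω` algebraically closed) valued by `V ∩ F` is a defectless field if it
is defectless in every finite subextension `E` of `Ω|F`**: a finite extension `L|F` embeds into
`Ω` over `F` (`IsAlgClosed.lift`), and defectlessness in `L` is defectlessness in its image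
(`IsDefectlessIn.congr`). [folklore] -/
theorem isDefectlessField_of_forall_intermediateField [IsAlgClosed Ω] (F : Subfield Ω)
    (h : ∀ E : IntermediateField F Ω, FiniteDimensional F E →
      IsDefectlessIn F (V.comap (algebraMap F Ω)) E) :
    IsDefectlessField F (V.comap (algebraMap F Ω)) := by
  intro L _ _ hfin
  haveI := hfin
  haveI : Algebra.IsAlgebraic F L := Algebra.IsAlgebraic.of_finite F L
  let φ : L →ₐ[F] Ω := IsAlgClosed.lift
  let ψ : L ≃ₐ[F] φ.fieldRange := φ.equivFieldRange
  haveI : FiniteDimensional F φ.fieldRange := Module.Finite.equiv ψ.toLinearEquiv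
  have hE := h φ.fieldRange inferInstance
  exact IsDefectlessIn.congr (L₁ := φ.fieldRange) (L₂ := L) (RingEquiv.refl F) ψ.symm.toRingEquiv
    (fun c => by
      change ψ.symm (algebraMap F φ.fieldRange c) = algebraMap F L c
      rw [AlgEquiv.commutes])
    (by ext c; simp [ValuationSubring.mem_comap]) hE

/-! ### Over a henselian subfield: `IsDefectlessExtension` is `IsDefectlessIn` -/

/-- `Set.range (K → Ω) = K` for an intermediate field `K` of `Ω` over a subfield. [folklore] -/
theorem range_algebraMap_intermediateField {F : Subfield Ω} (E : IntermediateField F Ω) :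
    Set.range (algebraMap E Ω) = (E : Set Ω) := by
  ext y
  constructor
  · rintro ⟨z, rfl⟩
    exact z.2
  · intro hy
    exact ⟨⟨y, hy⟩, rfl⟩

/-- An intermediate field of `Ω|F` is `Subfield.extendScalars` of its underlying subfield.
[folklore] -/
theorem extendScalars_toSubfield_eq {F : Subfield Ω} (E : IntermediateField F Ω)
    (hle : F ≤ E.toSubfield) : Subfield.extendScalars hle = E :=
  IntermediateField.toSubfield_injective (Subfield.extendScalars_toSubfield hle)

/-- `F ≤ E` for an intermediate field `E` of `Ω|F`. [folklore] -/
theorem subfield_le_toSubfield {F : Subfield Ω} (E : IntermediateField F Ω) : F ≤ E.toSubfield :=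
  fun y hy => E.algebraMap_mem ⟨y, hy⟩

/-- `[E : F] = Subfield.relfinrank F E` for an intermediate field `E` of `Ω|F`. [folklore] -/
theorem relfinrank_toSubfield_eq_finrank {F : Subfield Ω} (E : IntermediateField F Ω) :
    Subfield.relfinrank F E.toSubfield = Module.finrank F E := by
  rw [Subfield.relfinrank_eq_finrank_of_le (subfield_le_toSubfield E),
    extendScalars_toSubfield_eq E (subfield_le_toSubfield E)]

/-- **Over a henselian `F ≤ Ω`, `[E : F] = (vE : vF)·[Ev : Fv]` means that `(F, V ∩ F)` is
defectless in `E`** (Kuhlmann 2010, §1: "Note that `g = 1` if `(K,v)` is henselian" — the only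
extension of `V ∩ F` to the finite, hence algebraic, extension `E` is `V ∩ E`, and its `e`, `f`
are the relative index of `vF ≤ vE` and the relative degree of `Fv ≤ Ev`, `DefectAmbient.lean`).
PROVED. [cite: Kuhlmann2010, Section 1 and Section 2.3] -/
theorem isDefectlessIn_of_isDefectlessExtension (F : Subfield Ω)
    (hF : IsHenselianField F (V.comap (algebraMap F Ω))) (E : IntermediateField F Ω)
    [FiniteDimensional F E] (h : IsDefectlessExtension V F E.toSubfield) :
    IsDefectlessIn F (V.comap (algebraMap F Ω)) E := by
  classical
  obtain ⟨hle, -, heq⟩ := h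
  haveI : Algebra.IsAlgebraic F E := Algebra.IsAlgebraic.of_finite F E
  have hover : (V.comap (algebraMap E Ω)).comap (algebraMap F E) = V.comap (algebraMap F Ω) := by
    rw [ValuationSubring.comap_comap, ← IsScalarTower.algebraMap_eq]
  refine ⟨{V.comap (algebraMap E Ω)}, fun O' => ?_, ?_⟩
  · rw [Finset.mem_singleton]
    constructor
    · rintro rfl
      exact hover
    · intro hO'
      exact hF.eq_of_comap_eq hO' hover
  · have hrange : Set.range (algebraMap E Ω) = Set.range (algebraMap E.toSubfield Ω) := by
      rw [range_algebraMap_intermediateField, range_algebraMap_subfield]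
      rfl
    rw [Finset.sum_singleton, ramificationIndex_comap_eq_relIndex, inertiaDegree_comap_eq_relfinrank,
      valueSubgroup_eq_of_range_eq V hrange, residueSubfield_eq_of_range_eq V hrange, ← heq,
      relfinrank_toSubfield_eq_finrank]

/-! ### Unramified towers; Lemma 2.27 (Case II) as used on p. 19 -/

variable {V}

/-- **Finite unramified extensions compose** (inside `(Ω, V)`): degrees, residue degrees and
value groups behave multiplicatively resp. stay equal in a tower `H ≤ F ≤ N`, and separability
of residue field extensions is transitive (`IsSeparable.of_algebra_isSeparable_of_isSeparable`).
PROVED. [folklore] -/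
theorem IsUnramifiedOver.trans {H F N : Subfield Ω} (h₁ : IsUnramifiedOver V H F)
    (h₂ : IsUnramifiedOver V F N) : IsUnramifiedOver V H N := by
  obtain ⟨hHF, hpos₁, hdeg₁, hsep₁, hv₁⟩ := h₁
  obtain ⟨hFN, hpos₂, hdeg₂, hsep₂, hv₂⟩ := h₂
  have hrHF : residueSubfield H V ≤ residueSubfield F V := residueSubfield_subfield_mono hHF
  have hrFN : residueSubfield F V ≤ residueSubfield N V := residueSubfield_subfield_mono hFN
  refine ⟨hHF.trans hFN, ?_, ?_, ?_, hv₂.trans hv₁⟩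
  · rw [← Subfield.relfinrank_mul_relfinrank hHF hFN]
    exact Nat.mul_pos hpos₁ hpos₂
  · rw [← Subfield.relfinrank_mul_relfinrank hHF hFN, ← Subfield.relfinrank_mul_relfinrank hrHF hrFN,
      hdeg₁, hdeg₂]
  · -- separability in the tower `Hv ≤ Fv ≤ Nv`
    intro r hr
    let F' : IntermediateField (residueSubfield H V) (ResidueField V) := Subfield.extendScalars hrHF
    haveI : Algebra.IsSeparable (residueSubfield H V) F' :=
      ⟨fun y => IsSeparable.tower_bot (hsep₁ (y : ResidueField V) y.2)⟩
    let e : residueSubfield F V →+* F' :=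
      { toFun := fun y => ⟨y.1, y.2⟩
        map_one' := rfl
        map_mul' := fun _ _ => rfl
        map_zero' := rfl
        map_add' := fun _ _ => rfl }
    letI : Algebra (residueSubfield F V) F' := e.toAlgebra
    haveI : IsScalarTower (residueSubfield F V) F' (ResidueField V) :=
      IsScalarTower.of_algebraMap_eq fun _ => rfl
    have h1 : IsSeparable F' r := IsSeparable.tower_top F' (hsep₂ r hr)
    exact IsSeparable.of_algebra_isSeparable_of_isSeparable (F := residueSubfield H V) (E := F') h1

/-- **Kuhlmann 2010, Lemma 2.27, residue-transcendental case, in the form used on p. 19**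
("Lemma 2.27 shows that `N`, being a finite subextension inside `F^r`, is again a henselized
inertially generated function field … with a valuation-transcendental generator over `K`. Also,
it is again of rank 1"; Case II of its proof: "`(E|F,v)` is unramified and `(E|K,v)` is again a
henselized inertially generated function field with generator `x`"): a finite unramified
extension `N` of a field `F` of the class is in the class, with the same generator. PROVED
(unramified extensions compose). [cite: Kuhlmann2010, Lemma 2.27] -/
theorem IsHenselizedInertiallyGeneratedRT.of_isUnramifiedOver {K F N : Subfield Ω}
    (hF : IsHenselizedInertiallyGeneratedRT V K F) (hN : IsUnramifiedOver V F N) :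
    IsHenselizedInertiallyGeneratedRT V K N := by
  obtain ⟨x, hx, hr, hunr⟩ := hF
  exact ⟨x, hx, hr, hunr.trans hN⟩

/-! ### The induction of p. 20 -/


/-- **Kuhlmann 2010, p. 20: along a finite tower of normal extensions of degree `p` starting at a
field `M` of the class, every field of the tower is in the class and `M` is defectless in the
top** ("By Corollary 4.2 or Proposition 3.1, this extension is defectless. From the preceding
lemma we infer that `E'` is again a henselized inertially generated function field … By induction
hypothesis, `(E|E',v)` is also defectless … Hence by Lemma 2.13, `(E|N,v)` is defectless").
PROVED from the named facts `Kuhlmann2010NormalDegreePDefectless` (Cor. 4.2 / Prop. 3.1) and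
`Kuhlmann2010FiniteExtensionInertiallyGenerated` (Lemma 5.5), by induction on the tower, with
`IsDefectlessExtension.trans` (Lemma 2.13). [cite: Kuhlmann2010, Section 5, proof of (R4) (p. 20)] -/
theorem IsNormalPTower.isDefectlessExtension [IsAlgClosed Ω] {p : ℕ} [CharP (ResidueField V) p]
    (hp : p.Prime) {K : Subfield Ω} (hK : IsAlgClosed K)
    (hδ : Kuhlmann2010NormalDegreePDefectless.{u})
    (hζ : Kuhlmann2010FiniteExtensionInertiallyGenerated.{u}) {M T : Subfield Ω}
    (h : IsNormalPTower p M T) (hM : IsHenselizedInertiallyGeneratedRT V K M) :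
    IsDefectlessExtension V M T ∧ IsHenselizedInertiallyGeneratedRT V K T := by
  induction h with
  | refl M => exact ⟨isDefectlessExtension_self M, hM⟩
  | @step M M₁ T h₁ _ ih =>
    have hd₁ : IsDefectlessExtension V M M₁ := hδ Ω V p hp K M M₁ hK hM h₁
    have hM₁ : IsHenselizedInertiallyGeneratedRT V K M₁ :=
      hζ Ω V p hp K M M₁ hK hM h₁.le (by rw [h₁.relfinrank_eq]; exact hp.pos)
    obtain ⟨hd₂, hT⟩ := ih hM₁
    exact ⟨hd₁.trans hd₂, hT⟩

/-! ### Assembly -/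

/-- **Kuhlmann 2010, §5, proof of (R4) for the henselized rational function field `K(x)^h` with a
residue-transcendental generator, from its printed ingredients** (pp. 18–20). PROVED: let
`F = K(x)^h`, henselian by `Kuhlmann2010HenselizationIsHenselian`. If `char Fv = 0`, Cor. 2.12
(`Kuhlmann2010DefectlessOfResidueCharZero`). Otherwise `char Ωv = p > 0`; by
`isDefectlessField_of_forall_intermediateField` it suffices to treat a finite subextension `E` of
`Ω|F`. `F` is in the class (`isHenselizedInertiallyGeneratedRT_henselization`); the reduction
(`Kuhlmann2010TameTowerReduction`, pp. 18–19 with Lemma 2.27) gives a finite unramified `N|F` and a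
tower of normal extensions of degree `p` from `N` to `E.N`; `N` is in the class (Lemma 2.27,
`IsHenselizedInertiallyGeneratedRT.of_isUnramifiedOver`); the induction of p. 20
(`IsNormalPTower.isDefectlessExtension`) makes `E.N|N` defectless; Prop. 2.18
(`Kuhlmann2010DefectUnramifiedBaseChange`) then gives `[E : F] = (vE : vF)[Ev : Fv]`, which over
the henselian `F` is "`F` defectless in `E`" (`isDefectlessIn_of_isDefectlessExtension`).
[cite: Kuhlmann2010, Section 5, proof of (R4) (pp. 18–20)] -/
theorem Kuhlmann2010StabilityHenselizedRationalResidueTranscendental.of_parts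
    (h212 : Kuhlmann2010DefectlessOfResidueCharZero.{u})
    (hH : Kuhlmann2010HenselizationIsHenselian.{u})
    (hα : Kuhlmann2010TameTowerReduction.{u})
    (hγ : Kuhlmann2010DefectUnramifiedBaseChange.{u})
    (hδ : Kuhlmann2010NormalDegreePDefectless.{u})
    (hζ : Kuhlmann2010FiniteExtensionInertiallyGenerated.{u}) :
    Kuhlmann2010StabilityHenselizedRationalResidueTranscendental.{u} := by
  intro Ω _ _ V K x Kx hK hrt hKx hr1 hr2
  subst hKx
  -- `F = K(x)^h` is henselian
  have hFh := hH Ω V (IntermediateField.adjoin K ({x} : Set Ω)).toSubfield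
  rcases CharP.exists' (ResidueField V) with hc0 | ⟨p, ⟨hp⟩, hcp⟩
  · -- residue characteristic `0`: Cor. 2.12
    haveI := hc0
    exact h212 _ _ (residueFieldHom _ V).charZero
  · -- residue characteristic `p > 0`
    haveI := hcp
    have hFC : IsHenselizedInertiallyGeneratedRT V K
        (henselization V (IntermediateField.adjoin K ({x} : Set Ω)).toSubfield) :=
      isHenselizedInertiallyGeneratedRT_henselization hrt ⟨hr1, hr2⟩
    refine isDefectlessField_of_forall_intermediateField V _ fun E hfin => ?_
    haveI := hfin
    have hle := subfield_le_toSubfield E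
    have hpos : 0 < Subfield.relfinrank
        (henselization V (IntermediateField.adjoin K ({x} : Set Ω)).toSubfield) E.toSubfield := by
      rw [relfinrank_toSubfield_eq_finrank]
      exact Module.finrank_pos
    -- pp. 18–19: a finite unramified `N` and a tower of normal degree-`p` steps from `N` to `E.N`
    obtain ⟨N, hN, htower⟩ := hα Ω V p hp K _ E.toSubfield hK hFC hle hpos
    -- `N` is in the class (Lemma 2.27)
    have hNC : IsHenselizedInertiallyGeneratedRT V K N := hFC.of_isUnramifiedOver hN
    -- p. 20: `E.N|N` is defectless
    obtain ⟨⟨-, hposN, heqN⟩, -⟩ := htower.isDefectlessExtension hp hK hδ hζ hNC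
    -- Prop. 2.18: so is `E|F`
    have hγ' := hγ Ω V _ N E.toSubfield hFh hN hle hpos
    rw [← heqN, mul_comm] at hγ'
    have hdefF : IsDefectlessExtension V
        (henselization V (IntermediateField.adjoin K ({x} : Set Ω)).toSubfield) E.toSubfield :=
      ⟨hle, hpos, Nat.eq_of_mul_eq_mul_left hposN hγ'⟩
    exact isDefectlessIn_of_isDefectlessExtension V _ hFh E hdefF

/-- **The trust base of (R4) for `K(t)`, `t` residue-transcendental, after this layer**:
`Kuhlmann2010StabilityRankOneResidueTranscendental` from Thm. 2.14, Cor. 2.12, the reduction of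
pp. 18–19 (with Lemma 2.27), Prop. 2.18, Cor. 4.2 / Prop. 3.1 and Lemma 5.5 — the henselization
being henselian (§1.1) is PROVED (`Kuhlmann2010HenselizationIsHenselian_holds`,
`HenselizationHenselian.lean`). PROVED (`Kuhlmann2010StabilityRankOneResidueTranscendental.of_parts`
and the assembly above). [cite: Kuhlmann2010, Section 5, Lemma 5.4 (R4) and proof of (R4) (pp. 18–20)] -/
theorem Kuhlmann2010StabilityRankOneResidueTranscendental.of_ingredients
    (h214 : Kuhlmann2010DefectlessIffHenselization.{u})
    (h212 : Kuhlmann2010DefectlessOfResidueCharZero.{u})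
    (hα : Kuhlmann2010TameTowerReduction.{u})
    (hγ : Kuhlmann2010DefectUnramifiedBaseChange.{u})
    (hδ : Kuhlmann2010NormalDegreePDefectless.{u})
    (hζ : Kuhlmann2010FiniteExtensionInertiallyGenerated.{u}) :
    Kuhlmann2010StabilityRankOneResidueTranscendental.{u} :=
  Kuhlmann2010StabilityRankOneResidueTranscendental.of_parts h214
    (Kuhlmann2010StabilityHenselizedRationalResidueTranscendental.of_parts h212
      Kuhlmann2010HenselizationIsHenselian_holds hα hγ hδ hζ)

end Literature.AlgebraicGeometry.Resolution
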